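import Literature.NumberTheory.DiophantineGeometry.RationalFunctionHeight
import Literature.NumberTheory.DiophantineGeometry.GenEllPullbackConductor
import Mathlib.RingTheory.Polynomial.Tower
import HarnessLib

/-!
# Heights along a finite map `φ = (f : g) : ℙ¹ → ℙ¹` in the [GenEll] bookkeeping
# ([GenEll] Prop. 1.4 (i)+(iii) on `ℙ¹`; Silverman AEC Thm. VIII.5.6)

S. Mochizuki, *Arithmetic elliptic curves in general position*, Math. J. Okayama Univ. 52 (2010),
Prop. 1.4 (i), (iii) p. 6 (functoriality of heights and `ht_{L^{⊗n}} ≈ n·ht_L` up to bounded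
discrepancy), specialised to a finite self-map of `ℙ¹` of degree `n`: `ht(φ(y)) ≈ n·ht(y)` on
`ℙ¹(Q̄)`, the discrepancy being bounded INDEPENDENTLY of the field of definition once heights are
normalised by the degree ([GenEll] Def. 1.2 (i)).  In the tree's vocabulary: for a `P1FiniteMap`
`φ = (f, g, n)` (`GenEllPullbackConductor`, `f, g ∈ ℤ[t]`, `deg f, deg g ≤ n`) whose numerator and
denominator are COPRIME over `ℚ` and one of which has degree exactly `n` (i.e. `φ` has degree `n`):

* `P1FiniteMap.exists_abs_logHeight₁_div_sub_le_finrank` — field-uniform form: there is `C` with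
  `|h_K(f(y)/g(y)) − n·h_K(y)| ≤ C·[K:ℚ]` for every number field `K` and `y ∈ K`
  (`h_K = logHeight₁`), from `RationalFunctionHeight` (the Nullstellensatz certificate is built
  there from coprimality);
* `P1FiniteMap.exists_abs_normHeight_sub_le` — the NORMALISED form on presented points
  `P = (F, y)` (`NFPoint`, `P.ht = [F:ℚ]⁻¹·h_F(y)`):
  `|[F:ℚ]⁻¹·h_F(f(y)/g(y)) − n·P.ht| ≤ C`, uniformly in `P`;
* `P1FiniteMap.exists_mul_ht_le_add` / `exists_normHeight_le_add` — the two one-sided shapes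
  (`n·P.ht ≤ [F:ℚ]⁻¹·h_F(φ(y)) + C` is the premise of the Vojta-transfer lemmas along
  cusp-preserving maps; the other direction bounds the image height).

Classical; abc-iut cell support brick for GenEllTwo (stmt-ABC-19679: the maps `γ` of the menu and
the Belyi map `β`); nothing disputed is touched.  Theorems only, no definitions.
-/

noncomputable section

open Polynomial Height NumberField

namespace Literature.NumberTheory.DiophantineGeometry.GenEll

/-- Degrees survive the passage `ℤ[t] → ℚ[t]`. [folklore] -/
private theorem natDegree_map_int_rat (f : ℤ[X]) : (f.map (algebraMap ℤ ℚ)).natDegree = f.natDegree :=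
  natDegree_map_eq_of_injective (algebraMap ℤ ℚ).injective_int f

/-- Evaluating `f ∈ ℤ[t]` at `y ∈ K` through `ℚ[t]` is evaluating it directly.  [folklore] -/
private theorem aeval_map_int_rat {K : Type*} [Field K] [CharZero K] (f : ℤ[X]) (y : K) :
    aeval y (f.map (algebraMap ℤ ℚ)) = aeval y f :=
  aeval_map_algebraMap ℚ y f

namespace P1FiniteMap

/-- **[GenEll] Prop. 1.4 (i)+(iii) for a degree-`n` self-map of `ℙ¹`, field-uniform form** (Silverman
AEC Thm. VIII.5.6): for `φ = (f, g, n)` with `f, g` coprime over `ℚ` and `deg f = n` or `deg g = n`,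
there is `C` such that `|h_K(f(y)/g(y)) − n·h_K(y)| ≤ C·[K:ℚ]` for every number field `K` and every
`y ∈ K`. [cite: MochizukiGenEll2010, Prop 1.4 (iii) p.6] -/
theorem exists_abs_logHeight₁_div_sub_le_finrank (φ : P1FiniteMap)
    (hcop : IsCoprime (φ.num.map (algebraMap ℤ ℚ)) (φ.den.map (algebraMap ℤ ℚ)))
    (hdeg : φ.num.natDegree = φ.deg ∨ φ.den.natDegree = φ.deg) :
    ∃ C : ℝ, ∀ (K : Type) [Field K] [NumberField K] (y : K),
      |logHeight₁ (aeval y φ.num / aeval y φ.den) - φ.deg * logHeight₁ y| ≤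
        C * Module.finrank ℚ K := by
  have hp : (φ.num.map (algebraMap ℤ ℚ)).natDegree ≤ φ.deg :=
    (natDegree_map_int_rat φ.num).le.trans φ.natDegree_num_le
  have hq : (φ.den.map (algebraMap ℤ ℚ)).natDegree ≤ φ.deg :=
    (natDegree_map_int_rat φ.den).le.trans φ.natDegree_den_le
  have hn : (φ.num.map (algebraMap ℤ ℚ)).natDegree = φ.deg ∨
      (φ.den.map (algebraMap ℤ ℚ)).natDegree = φ.deg := by
    rwa [natDegree_map_int_rat, natDegree_map_int_rat]
  obtain ⟨C, hC⟩ :=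
    Literature.NumberTheory.DiophantineGeometry.exists_abs_logHeight₁_div_sub_le_finrank
      (k := ℚ) hcop hp hq hn
  refine ⟨C, fun K _ _ y => ?_⟩
  have h := hC K y
  rwa [aeval_map_int_rat, aeval_map_int_rat] at h

/-- **Normalised form on presented points** ([GenEll] Def. 1.2 (i): heights of `ℙ¹(Q̄)`-points are
normalised by the degree of the field of presentation): for `φ` as above there is `C` with
`|[F:ℚ]⁻¹·h_F(f(y)/g(y)) − n·P.ht| ≤ C` for every presented point `P = (F, y)`.
[cite: MochizukiGenEll2010, Prop 1.4 (iii) p.6] -/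
theorem exists_abs_normHeight_sub_le (φ : P1FiniteMap)
    (hcop : IsCoprime (φ.num.map (algebraMap ℤ ℚ)) (φ.den.map (algebraMap ℤ ℚ)))
    (hdeg : φ.num.natDegree = φ.deg ∨ φ.den.natDegree = φ.deg) :
    ∃ C : ℝ, ∀ P : NFPoint,
      |(P.degree : ℝ)⁻¹ * logHeight₁ (aeval P.x φ.num / aeval P.x φ.den) - φ.deg * P.ht| ≤ C := by
  obtain ⟨C, hC⟩ := φ.exists_abs_logHeight₁_div_sub_le_finrank hcop hdeg
  refine ⟨C, fun P => ?_⟩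
  have h := hC P.F P.x
  have hd : (0 : ℝ) < P.degree := by exact_mod_cast P.degree_pos
  have hdeg' : (Module.finrank ℚ P.F : ℝ) = P.degree := rfl
  rw [hdeg'] at h
  -- divide the field-uniform inequality by the degree
  have key : (P.degree : ℝ)⁻¹ * logHeight₁ (aeval P.x φ.num / aeval P.x φ.den) - φ.deg * P.ht =
      (P.degree : ℝ)⁻¹ * (logHeight₁ (aeval P.x φ.num / aeval P.x φ.den) - φ.deg * logHeight₁ P.x) := by
    unfold NFPoint.ht
    ring
  rw [key, abs_mul, abs_of_pos (inv_pos.mpr hd)]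
  calc (P.degree : ℝ)⁻¹ * |logHeight₁ (aeval P.x φ.num / aeval P.x φ.den) - φ.deg * logHeight₁ P.x|
      ≤ (P.degree : ℝ)⁻¹ * (C * P.degree) := mul_le_mul_of_nonneg_left h (inv_pos.mpr hd).le
    _ = C := by field_simp

/-- **Lower bound, one-sided shape**: `n·P.ht ≤ [F:ℚ]⁻¹·h_F(f(y)/g(y)) + C` for every presented point
`P = (F, y)` — the premise of the Vojta-transfer lemmas along `φ` ("`φ^*` of an ample bundle is ample":
pulling back loses no height up to `O(1)`). [cite: MochizukiGenEll2010, Prop 1.4 (iii) p.6] -/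
theorem exists_mul_ht_le_add (φ : P1FiniteMap)
    (hcop : IsCoprime (φ.num.map (algebraMap ℤ ℚ)) (φ.den.map (algebraMap ℤ ℚ)))
    (hdeg : φ.num.natDegree = φ.deg ∨ φ.den.natDegree = φ.deg) :
    ∃ C : ℝ, ∀ P : NFPoint,
      φ.deg * P.ht ≤ (P.degree : ℝ)⁻¹ * logHeight₁ (aeval P.x φ.num / aeval P.x φ.den) + C := by
  obtain ⟨C, hC⟩ := φ.exists_abs_normHeight_sub_le hcop hdeg
  refine ⟨C, fun P => ?_⟩
  have h := abs_le.mp (hC P)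
  linarith [h.1]

/-- **Upper bound, one-sided shape**: `[F:ℚ]⁻¹·h_F(f(y)/g(y)) ≤ n·P.ht + C` for every presented
point `P = (F, y)`. [cite: MochizukiGenEll2010, Prop 1.4 (iii) p.6] -/
theorem exists_normHeight_le_add (φ : P1FiniteMap)
    (hcop : IsCoprime (φ.num.map (algebraMap ℤ ℚ)) (φ.den.map (algebraMap ℤ ℚ)))
    (hdeg : φ.num.natDegree = φ.deg ∨ φ.den.natDegree = φ.deg) :
    ∃ C : ℝ, ∀ P : NFPoint,
      (P.degree : ℝ)⁻¹ * logHeight₁ (aeval P.x φ.num / aeval P.x φ.den) ≤ φ.deg * P.ht + C := by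
  obtain ⟨C, hC⟩ := φ.exists_abs_normHeight_sub_le hcop hdeg
  refine ⟨C, fun P => ?_⟩
  have h := abs_le.mp (hC P)
  linarith [h.2]

end P1FiniteMap

end Literature.NumberTheory.DiophantineGeometry.GenEll

end
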